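import Summits.Schanuel.Statement
import Literature.NumberTheory.Transcendental.SchanuelEclEmpty

/-!
# Schanuel / EclCore — assembly

Route `Schanuel/EclCore`. Thesis X (stmt-Schanuel-0066): Schanuel's conjecture restricted to
`ℚ`-linearly independent tuples with all entries in Kirby's exponential-algebraic closure
`ecl(∅) ⊆ ℂ` (`Literature.ecl ∅`); the docstring "Restricted" below refers to that thesis inline. Kirby (Bull. LMS 42 (2010), Prop. 7.2 and §1) shows every essential
counterexample to Schanuel lies in `ecl(∅)`, so the restriction is equivalent to the full
conjecture; that equivalence is the named fact `Literature.NumberTheory.Transcendental.schanuelConjecture_iff_ecl_empty`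
(Literature/NumberTheory/Transcendental/SchanuelEclEmpty.lean, nothing asserted).

This file settles the assembly item stmt-Schanuel-0408 (hypothesis = the fact's body with
`Literature.Periods.SchanuelConjecture` on the left; `Schanuel` unfolds to it) and records the same
packaging against the landed fact name (`SchanuelProperty ℂ` on the left, `Iff.rfl`-equal).
-/

namespace Schanuel.EclCore

/-- `Schanuel` is, definitionally, the Schanuel property of `ℂ_exp`. [folklore] -/
theorem schanuel_iff_schanuelProperty : Schanuel ↔ Literature.ModelTheory.ExponentialFields.SchanuelProperty ℂ := Iff.rfl

/-- Settles stmt-Schanuel-0408 (assembly of route EclCore): Kirby's equivalence (taken as the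
hypothesis, body inlined) and the restricted conjecture give `Schanuel`. [folklore] -/
theorem eclcore_assembly_v2 :
    (Literature.Periods.SchanuelConjecture ↔ (∀ (n : ℕ) (x : Fin n → ℂ), (∀ i, x i ∈ Literature.NumberTheory.Transcendental.ecl (∅ : Set ℂ)) → LinearIndependent ℚ x → (n : Cardinal) ≤ Algebra.trdeg ℚ ↥(IntermediateField.adjoin ℚ (Set.range x ∪ Set.range (Complex.exp ∘ x))))) → (∀ (n : ℕ) (x : Fin n → ℂ), (∀ i, x i ∈ Literature.NumberTheory.Transcendental.ecl (∅ : Set ℂ)) → LinearIndependent ℚ x → (n : Cardinal) ≤ Algebra.trdeg ℚ ↥(IntermediateField.adjoin ℚ (Set.range x ∪ Set.range (Complex.exp ∘ x)))) → Schanuel :=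
  fun h hX => h.mpr hX

/-- The same assembly against the landed named fact
`Literature.NumberTheory.Transcendental.schanuelConjecture_iff_ecl_empty` (canonical D-0014 shape). [folklore] -/
theorem eclcore_assembly_fact :
    Literature.NumberTheory.Transcendental.schanuelConjecture_iff_ecl_empty →
      (∀ (n : ℕ) (x : Fin n → ℂ), (∀ i, x i ∈ Literature.NumberTheory.Transcendental.ecl (∅ : Set ℂ)) → LinearIndependent ℚ x → (n : Cardinal) ≤ Algebra.trdeg ℚ ↥(IntermediateField.adjoin ℚ (Set.range x ∪ Set.range (Complex.exp ∘ x)))) → Schanuel :=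
  fun h hX => h.mpr hX

end Schanuel.EclCore
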